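import Mathlib
import Summits.Ventures.HodgeRepro2.T5HermitianIsotropicForm

/-!
# The orthogonal complement of a hyperbolic pair in three variables is a line

Blind cell `pub-hodge-repro2`, seat p8 (gen 13), Tier-5 kernel support.  For a hermitian form
`⟨·,·⟩_H` on `E³` and a hyperbolic pair `e, f` (`⟨e,e⟩ = 0 = ⟨f,f⟩`, `⟨e,f⟩ = 1 = ⟨f,e⟩`):

* `pairMatrix H e f` — the `2 × 3` matrix of the system `⟨e, ·⟩ = 0 = ⟨f, ·⟩`
  (`pairMatrix_mulVec`);
* `pairingLin` / `projPerp` — the pairing as a linear functional and the projection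
  `π v = v - ⟨f, v⟩ e - ⟨e, v⟩ f` onto `(e, f)^⊥` (`sesqForm_projPerp`);
* `range_pairMatrix_eq_top` / `finrank_ker_pairMatrix` — the system is onto `E²`, so its kernel
  `(e, f)^⊥` has dimension `3 - 2 = 1`;
* `exists_smul_eq_of_orthogonal` — **every vector orthogonal to `e` and `f` is a multiple of any
  fixed non-zero one**.

Used by `T5HermitianIsotropicLattice` (the integral normal form).

README §8(d): uses an L-value-free non-vanishing device: NO.
-/

namespace Summit.Ventures.HodgeRepro2.T5HyperbolicComplement

open Matrix T5UnitaryGroupIsometry T5HermitianIsotropicForm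

section Orthogonal

variable {E : Type*} [Field E] [StarRing E]

/-- The `2 × 3` matrix of the system `⟨e, ·⟩_H = 0 = ⟨f, ·⟩_H`. -/
def pairMatrix (H : Matrix (Fin 3) (Fin 3) E) (e f : Fin 3 → E) : Matrix (Fin 2) (Fin 3) E :=
  Matrix.of ![star e ᵥ* H, star f ᵥ* H]

/-- `pairMatrix H e f *ᵥ v = ![⟨e, v⟩_H, ⟨f, v⟩_H]`. -/
theorem pairMatrix_mulVec (H : Matrix (Fin 3) (Fin 3) E) (e f v : Fin 3 → E) :
    pairMatrix H e f *ᵥ v = ![sesqForm H e v, sesqForm H f v] := by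
  funext i
  fin_cases i <;> simp [pairMatrix, mulVec, sesqForm, dotProduct_mulVec]

/-- The pairing `⟨e, ·⟩_H` as a linear functional. -/
def pairingLin (H : Matrix (Fin 3) (Fin 3) E) (e : Fin 3 → E) : (Fin 3 → E) →ₗ[E] E where
  toFun := sesqForm H e
  map_add' := sesqForm_add_right H e
  map_smul' c w := by
    rw [RingHom.id_apply, smul_eq_mul]
    exact sesqForm_smul_right H e w c

/-- `pairingLin H e v = ⟨e, v⟩_H`. -/
theorem pairingLin_apply (H : Matrix (Fin 3) (Fin 3) E) (e v : Fin 3 → E) :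
    pairingLin H e v = sesqForm H e v := rfl

/-- The projection onto `(e, f)^⊥` along the hyperbolic plane:
`π v = v - ⟨f, v⟩ e - ⟨e, v⟩ f`. -/
def projPerp (H : Matrix (Fin 3) (Fin 3) E) (e f : Fin 3 → E) : (Fin 3 → E) →ₗ[E] (Fin 3 → E) :=
  LinearMap.id - (pairingLin H f).smulRight e - (pairingLin H e).smulRight f

/-- `π v = v - ⟨f, v⟩ • e - ⟨e, v⟩ • f`. -/
theorem projPerp_apply (H : Matrix (Fin 3) (Fin 3) E) (e f v : Fin 3 → E) :
    projPerp H e f v = v - sesqForm H f v • e - sesqForm H e v • f := rfl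

/-- `π v` is orthogonal to `e` and to `f` (for a hyperbolic pair `e, f`). -/
theorem sesqForm_projPerp {H : Matrix (Fin 3) (Fin 3) E} {e f : Fin 3 → E}
    (hee : sesqForm H e e = 0) (hef : sesqForm H e f = 1) (hfe : sesqForm H f e = 1)
    (hff : sesqForm H f f = 0) (v : Fin 3 → E) :
    sesqForm H e (projPerp H e f v) = 0 ∧ sesqForm H f (projPerp H e f v) = 0 := by
  rw [projPerp_apply]
  constructor
  · rw [sesqForm_sub_right, sesqForm_sub_right, sesqForm_smul_right, sesqForm_smul_right, hee, hef]
    ring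
  · rw [sesqForm_sub_right, sesqForm_sub_right, sesqForm_smul_right, sesqForm_smul_right, hfe, hff]
    ring

/-- The system `⟨e, ·⟩ = 0 = ⟨f, ·⟩` is surjective onto `E²` for a hyperbolic pair. -/
theorem range_pairMatrix_eq_top {H : Matrix (Fin 3) (Fin 3) E} {e f : Fin 3 → E}
    (hee : sesqForm H e e = 0) (hef : sesqForm H e f = 1) (hfe : sesqForm H f e = 1)
    (hff : sesqForm H f f = 0) : (Matrix.toLin' (pairMatrix H e f)).range = ⊤ := by
  rw [LinearMap.range_eq_top]
  intro w
  refine ⟨w 1 • e + w 0 • f, ?_⟩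
  rw [Matrix.toLin'_apply, pairMatrix_mulVec, sesqForm_add_right, sesqForm_add_right,
    sesqForm_smul_right, sesqForm_smul_right, sesqForm_smul_right, sesqForm_smul_right, hee, hef,
    hfe, hff]
  funext i
  fin_cases i <;> simp

/-- The orthogonal complement `(e, f)^⊥` of a hyperbolic pair in `E³` is a line. -/
theorem finrank_ker_pairMatrix {H : Matrix (Fin 3) (Fin 3) E} {e f : Fin 3 → E}
    (hee : sesqForm H e e = 0) (hef : sesqForm H e f = 1) (hfe : sesqForm H f e = 1)
    (hff : sesqForm H f f = 0) :
    Module.finrank E (LinearMap.ker (Matrix.toLin' (pairMatrix H e f))) = 1 := by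
  have h := LinearMap.finrank_range_add_finrank_ker (Matrix.toLin' (pairMatrix H e f))
  rw [range_pairMatrix_eq_top hee hef hfe hff, finrank_top, Module.finrank_fin_fun,
    Module.finrank_fin_fun] at h
  omega

/-- **Every vector orthogonal to a hyperbolic pair is a multiple of a fixed non-zero one.** -/
theorem exists_smul_eq_of_orthogonal {H : Matrix (Fin 3) (Fin 3) E} {e f : Fin 3 → E}
    (hee : sesqForm H e e = 0) (hef : sesqForm H e f = 1) (hfe : sesqForm H f e = 1)
    (hff : sesqForm H f f = 0) {x₀ : Fin 3 → E} (hx₀ : x₀ ≠ 0) (hex : sesqForm H e x₀ = 0)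
    (hfx : sesqForm H f x₀ = 0) {y : Fin 3 → E} (hey : sesqForm H e y = 0)
    (hfy : sesqForm H f y = 0) : ∃ c : E, c • x₀ = y := by
  have hmem : ∀ {v : Fin 3 → E}, sesqForm H e v = 0 → sesqForm H f v = 0 →
      v ∈ LinearMap.ker (Matrix.toLin' (pairMatrix H e f)) := by
    intro v h1 h2
    rw [LinearMap.mem_ker, Matrix.toLin'_apply, pairMatrix_mulVec, h1, h2]
    funext i
    fin_cases i <;> rfl
  have hx₀' : (⟨x₀, hmem hex hfx⟩ : LinearMap.ker (Matrix.toLin' (pairMatrix H e f))) ≠ 0 := by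
    intro h
    exact hx₀ (congrArg Subtype.val h)
  obtain ⟨c, hc⟩ := (finrank_eq_one_iff_of_nonzero' _ hx₀').mp (finrank_ker_pairMatrix hee hef hfe hff)
    ⟨y, hmem hey hfy⟩
  exact ⟨c, congrArg Subtype.val hc⟩

end Orthogonal

end Summit.Ventures.HodgeRepro2.T5HyperbolicComplement
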